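import Summits.ResolutionOfSingularities.ResolutionOfSingularities.Theorems.WildConesClassicalRegimesStubMuDropCharTwoOrdPInduction

/-!
# Milnor drop in characteristic two (`stub_muDropCharTwoOrdP`) — piece (L): low dimensions, every chart

Helper file for the stub `stub_muDropCharTwoOrdP` of crux `ClassicalRegimes`
(stmt-ResolutionOfSingularities-16884, route `WildCones`, line `milnor-descent`; chain W4.1 on the door
`IsolatedForcedTermination` stmt-ResolutionOfSingularities-16343, plan-of-record `CHAIN.md` v0/v1,
piece (L) `stub_pairDropLow`): the one-step drop of the Milnor number
`μ = dim_κ κ⟦u₁,…,uₙ⟧/(∂a)` of the cleaned state of `z² = a(u)` under the point-blow-up dynamics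
in characteristic two. The FORMAL statement (on power series, for a chart index `i` and a
translation vector `τ`): if `X_i² G = a∘Φ_{i,τ}` with `ord a ≥ 2`, `G` without linear terms, and
both Milnor algebras `κ⟦X⟧/(∂a)`, `κ⟦X⟧/(∂G)` finite over `κ`, then
`dim κ⟦X⟧/(∂G) < dim κ⟦X⟧/(∂a)`.

This file: (1) the TRANSPORT of that whole statement along a permutation of the variables, for
general `n` (`series_drop_of_rename`: the strict-transform relation, the order bound, the absence
of linear terms and both Milnor algebras move along `MvPowerSeries.rename`; the pointwise lemmas
`rename_subst_blowFam`, `milnorAlg_equiv_rename`, `coeff_single_rename` are imported from the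
sibling file `…Induction.lean`), and (2) an independent second proof of the LOW-DIMENSIONAL cases
`n ≤ 2` for EVERY chart (`series_drop_le_two`): `n = 1` is the curve leaf `curve_drop`; for `n = 2`
the `x y`-coefficient of `a` vanishes (a hyperbolic pair avoiding the chart index cannot exist in
two variables, `coeff_pair_eq_zero_two` from `exists_pair_ne`), chart `0` is the surface leaf
`surface_drop`, and chart `1` is transported to chart `0` by `series_drop_of_rename` at the swap.
Sources: folklore (renaming variables commutes with substitution and with partial derivatives);
the leaves cite G.-M. Greuel, G. Pfister, arXiv:2507.17078 (hyperbolic pair) and E. Casas-Alvero,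
*Singularities of Plane Curves*, §3 (Noether's formula) in their own files.
-/

noncomputable section

-- single-problem summit: the doubled namespace component `ResolutionOfSingularities` is forced
set_option linter.dupNamespace false

open scoped BigOperators Classical

open MvPowerSeries IsLocalRing

open Literature.AlgebraicGeometry.Resolution

namespace Summit.ResolutionOfSingularities.ResolutionOfSingularities.Theorems.WildCones

namespace MuDropCharTwoOrdP

variable {κ : Type} [Field κ]

/-! ## Transport of the formal drop along a permutation of the variables -/

section Transport

variable {n : ℕ} (σ : Fin n ≃ Fin n)

/-- Renaming does not create linear terms. [folklore] -/
theorem coeff_single_rename_eq_zero {G : MvPowerSeries (Fin n) κ}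
    (hG : ∀ s, coeff (Finsupp.single s 1) G = 0) (t : Fin n) :
    coeff (Finsupp.single t 1) (rename σ G) = 0 := by
  have h := coeff_single_rename σ (σ.symm t) G
  rwa [Equiv.apply_symm_apply, hG] at h

/-- Renaming preserves `ord ≥ 2`. [folklore] -/
theorem two_le_order_rename {a : MvPowerSeries (Fin n) κ} (ha : 2 ≤ a.order) :
    2 ≤ (rename σ a).order := by
  have := le_order_algEquiv (renameEquiv κ σ) ha
  rwa [renameEquiv_apply] at this

/-- **TRANSPORT OF THE FORMAL DROP ALONG A PERMUTATION OF THE VARIABLES** (general `n`). The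
strict-transform relation `X_i² G = a∘Φ_{i,τ}` becomes `X_{σ i}² (σ G) = (σ a)∘Φ_{σ i, τ∘σ⁻¹}`, and
both Milnor algebras move along `rename σ`; hence the drop for the data `(σ i, τ∘σ⁻¹, σ a, σ G)`
gives the drop for `(i, τ, a, G)`. [folklore] -/
theorem series_drop_of_rename (i : Fin n) (τ : Fin n → κ) {a G : MvPowerSeries (Fin n) κ}
    (hG : X i ^ 2 * G = subst (fun s => if s = i then (X i : MvPowerSeries (Fin n) κ)
      else X i * (X s + C (τ s))) a)
    (h : X (σ i) ^ 2 * rename σ G = subst (fun t => if t = σ i then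
        (X (σ i) : MvPowerSeries (Fin n) κ) else X (σ i) * (X t + C (τ (σ.symm t)))) (rename σ a) →
      Module.Finite κ (MvPowerSeries (Fin n) κ ⧸
        Ideal.span (Set.range fun s => MvPowerSeries.pderiv s (rename σ a))) →
      Module.Finite κ (MvPowerSeries (Fin n) κ ⧸
        Ideal.span (Set.range fun s => MvPowerSeries.pderiv s (rename σ G))) →
      Module.finrank κ (MvPowerSeries (Fin n) κ ⧸
          Ideal.span (Set.range fun s => MvPowerSeries.pderiv s (rename σ G))) <
        Module.finrank κ (MvPowerSeries (Fin n) κ ⧸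
          Ideal.span (Set.range fun s => MvPowerSeries.pderiv s (rename σ a))))
    (hfa : Module.Finite κ (MvPowerSeries (Fin n) κ ⧸
      Ideal.span (Set.range fun s => MvPowerSeries.pderiv s a)))
    (hfG : Module.Finite κ (MvPowerSeries (Fin n) κ ⧸
      Ideal.span (Set.range fun s => MvPowerSeries.pderiv s G))) :
    Module.finrank κ (MvPowerSeries (Fin n) κ ⧸
        Ideal.span (Set.range fun s => MvPowerSeries.pderiv s G)) <
      Module.finrank κ (MvPowerSeries (Fin n) κ ⧸
        Ideal.span (Set.range fun s => MvPowerSeries.pderiv s a)) := by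
  obtain ⟨εa⟩ := milnorAlg_equiv_rename σ a
  obtain ⟨εG⟩ := milnorAlg_equiv_rename σ G
  have hG' : X (σ i) ^ 2 * rename σ G = subst (fun t => if t = σ i then
      (X (σ i) : MvPowerSeries (Fin n) κ) else X (σ i) * (X t + C (τ (σ.symm t)))) (rename σ a) := by
    rw [← rename_subst_blowFam, ← hG, map_mul, map_pow, rename_X]
  have := h hG' (Module.Finite.equiv εa.toLinearEquiv) (Module.Finite.equiv εG.toLinearEquiv)
  rwa [← εa.toLinearEquiv.finrank_eq, ← εG.toLinearEquiv.finrank_eq] at this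

end Transport

/-! ## The low-dimensional cases of the formal drop, every chart -/

section Low

/-- In two variables a hyperbolic pair avoiding the chart index cannot exist: if `X_i² G = a∘Φ`
with `ord a ≥ 2` and `G` has no linear terms, then the `x y`-coefficient of `a` vanishes
(char. two). [folklore] -/
theorem coeff_pair_eq_zero_two [CharP κ 2] (i : Fin 2) (τ : Fin 2 → κ)
    {a G : MvPowerSeries (Fin 2) κ} (ha : 2 ≤ a.order)
    (hG : X i ^ 2 * G = subst (fun s => if s = i then (X i : MvPowerSeries (Fin 2) κ)
      else X i * (X s + C (τ s))) a)
    (hG0 : ∀ s, coeff (Finsupp.single s 1) G = 0) :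
    coeff (Finsupp.single 0 1 + Finsupp.single 1 1) a = 0 := by
  by_contra hne
  obtain ⟨j, l, hjl, hj, hl, -⟩ := exists_pair_ne i τ ha hG hG0 ⟨0, 1, by decide, hne⟩
  have hcard : ({j, l, i} : Finset (Fin 2)).card = 3 := by
    rw [Finset.card_insert_of_notMem (by simp [hjl, hj]), Finset.card_insert_of_notMem (by simp [hl]),
      Finset.card_singleton]
  have := Finset.card_le_univ ({j, l, i} : Finset (Fin 2))
  rw [hcard, Fintype.card_fin] at this
  omega

/-- **THE SURFACE CASE, CHART `0`** (the surface leaf once the `x y`-coefficient is gone).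
[folklore] -/
theorem series_drop_two_zero [CharP κ 2] (τ : Fin 2 → κ) {a G : MvPowerSeries (Fin 2) κ}
    (ha : 2 ≤ a.order) (hG0 : ∀ s, coeff (Finsupp.single s 1) G = 0)
    (hG : X 0 ^ 2 * G = subst (fun s => if s = (0 : Fin 2) then (X 0 : MvPowerSeries (Fin 2) κ)
      else X 0 * (X s + C (τ s))) a)
    (hfa : Module.Finite κ (MvPowerSeries (Fin 2) κ ⧸
      Ideal.span (Set.range fun s => MvPowerSeries.pderiv s a)))
    (hfG : Module.Finite κ (MvPowerSeries (Fin 2) κ ⧸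
      Ideal.span (Set.range fun s => MvPowerSeries.pderiv s G))) :
    Module.finrank κ (MvPowerSeries (Fin 2) κ ⧸
        Ideal.span (Set.range fun s => MvPowerSeries.pderiv s G)) <
      Module.finrank κ (MvPowerSeries (Fin 2) κ ⧸
        Ideal.span (Set.range fun s => MvPowerSeries.pderiv s a)) :=
  surface_drop τ ha (coeff_pair_eq_zero_two 0 τ ha hG hG0) hG hfa hfG

/-- **THE SURFACE CASE, ANY CHART** (chart `1` is transported to chart `0` by the swap of the two
variables, `series_drop_of_rename`). [folklore] -/
theorem series_drop_two [CharP κ 2] (i : Fin 2) (τ : Fin 2 → κ) {a G : MvPowerSeries (Fin 2) κ}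
    (ha : 2 ≤ a.order) (hG0 : ∀ s, coeff (Finsupp.single s 1) G = 0)
    (hG : X i ^ 2 * G = subst (fun s => if s = i then (X i : MvPowerSeries (Fin 2) κ)
      else X i * (X s + C (τ s))) a)
    (hfa : Module.Finite κ (MvPowerSeries (Fin 2) κ ⧸
      Ideal.span (Set.range fun s => MvPowerSeries.pderiv s a)))
    (hfG : Module.Finite κ (MvPowerSeries (Fin 2) κ ⧸
      Ideal.span (Set.range fun s => MvPowerSeries.pderiv s G))) :
    Module.finrank κ (MvPowerSeries (Fin 2) κ ⧸
        Ideal.span (Set.range fun s => MvPowerSeries.pderiv s G)) <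
      Module.finrank κ (MvPowerSeries (Fin 2) κ ⧸
        Ideal.span (Set.range fun s => MvPowerSeries.pderiv s a)) := by
  fin_cases i
  · exact series_drop_two_zero τ ha hG0 hG hfa hfG
  · -- chart `1`: swap the variables
    refine series_drop_of_rename (Equiv.swap (0 : Fin 2) 1) 1 τ hG (fun h hfa' hfG' => ?_) hfa hfG
    have hswap : (Equiv.swap (0 : Fin 2) 1) 1 = 0 := Equiv.swap_apply_right _ _
    rw [hswap] at h
    exact series_drop_two_zero _ (two_le_order_rename _ ha)
      (coeff_single_rename_eq_zero _ hG0) h hfa' hfG'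

/-- **THE LOW-DIMENSIONAL CASES `n ≤ 2` OF THE FORMAL MILNOR DROP** (characteristic two; every
chart index `i`, every translation `τ`): `n = 0` is vacuous (no chart index), `n = 1` is the
curve leaf, `n = 2` the surface leaf in either chart. [folklore] -/
theorem series_drop_le_two [CharP κ 2] {n : ℕ} (hn : n ≤ 2) (i : Fin n) (τ : Fin n → κ)
    {a G : MvPowerSeries (Fin n) κ}
    (ha : 2 ≤ a.order) (hG0 : ∀ s, coeff (Finsupp.single s 1) G = 0)
    (hG : X i ^ 2 * G = subst (fun s => if s = i then (X i : MvPowerSeries (Fin n) κ)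
      else X i * (X s + C (τ s))) a)
    (hfa : Module.Finite κ (MvPowerSeries (Fin n) κ ⧸
      Ideal.span (Set.range fun s => MvPowerSeries.pderiv s a)))
    (hfG : Module.Finite κ (MvPowerSeries (Fin n) κ ⧸
      Ideal.span (Set.range fun s => MvPowerSeries.pderiv s G))) :
    Module.finrank κ (MvPowerSeries (Fin n) κ ⧸
        Ideal.span (Set.range fun s => MvPowerSeries.pderiv s G)) <
      Module.finrank κ (MvPowerSeries (Fin n) κ ⧸
        Ideal.span (Set.range fun s => MvPowerSeries.pderiv s a)) := by
  interval_cases n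
  · exact i.elim0
  · exact curve_drop i τ hG hfG
  · exact series_drop_two i τ ha hG0 hG hfa hfG

end Low

end MuDropCharTwoOrdP

end Summit.ResolutionOfSingularities.ResolutionOfSingularities.Theorems.WildCones

end
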